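import Literature.MathematicalPhysics.QuantumFieldTheory.Balaban1983to89.B6IMSTermsKLevelV1
import HarnessLib

/-!
# `Balaban1983to89.B6Ineq2140GradGDivKLevelV1` — T. Bałaban, *Propagators and renormalization transformations for lattice gauge theories. II*,
Commun. Math. Phys. **96** (1984) 223–250 [Balaban1984PropagatorsII], Prop. 2.6 (2.140)₄ p. 247: **`‖Δ(y)∇G(𝔅)∇*Δ(y′)‖ ≤ A e^{−δ d_T(y,y′)}`
ON THE GENUINE k-LEVEL V1 TORUS FAMILY, FROM THE LOCALISED ENERGY IDENTITY** — file F4d of the interior-energy route (cell pub-ymgap, seat dag-p1,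
`HOME/pub-ymgap-dag-p1/HL3-PLAN.md`; lit-balaban GAPS G-B6-2140-456): per member of the family and per pair of blocks, the block piece of
`∇_ν G∇*_μ u` (`supp u ⊂ Δ(y′)`) is bounded through `B6VecIMSV1.ims_deltaAE` with the cut-off of `B6CutoffSupportKLevelV1.exists_blockCutoffT`, the
term bounds of `B6IMSTermsKLevelV1` ∕ `B6IMSTermsV1`, the `ℓ²` majorant of `∂(1−R)∂*` (`B6QFormDgL2KLevelV1`) and the block bound (2.140)₂ for `G∇*`.
HONEST FRAMING (programme rule): statement-level skeleton of published theorems with citation tags; proofs where landed; nothing here is a claim about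
the Yang–Mills mass gap.  Finite-lattice `ℓ²` bookkeeping; the inputs (2.140)₂ and (2.88) enter BY NAME as hypotheses of the per-member theorem; no
estimate of print is asserted beyond what those inputs give; THEOREMS ONLY; nothing continuum ∕ mass-gap ∕ Clay.
WHAT IS PROVED (0 sorry; standard axioms): **`l2n_blockPiece_DGDa_le`** — for one member, given (2.61) at rate `a`, the `ℓ²` majorants of `∂(1−R)∂*`
(rate `δ_P ≥ a + δ_e`) and of `G∇*_μ` (rate `δ_H ≥ δ_e`, the shape (2.140)₂), and the level window `4(d+1)+2L+5 < R·L·M_h − 1`: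
`‖Δ(y)∇_νG∇*_μΔ(y′)u‖ ≤ (e^{δ_e(4d+5)} + √B)·e^{−δ_e d_T(y,y′)}‖u‖` with `B` explicit in `(d, L, K, a, A₂, δ_H, C, b₁, δ_e)`.
Seat `pub-ymgap-dag-p1` (prover), 2026-08-25.  NOT summit progress.
-/

open scoped BigOperators InnerProductSpace

noncomputable section

namespace Literature.MathematicalPhysics.QuantumFieldTheory.Balaban1983to89.B6Ineq2140GradGDivKLevelV1

open Finset
open LatticeFieldCalculus B6SectAOperatorsV1 B6SectAVectorModelV1
open B6MultiLevelBoxOperator (N0)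
open B6MultiLevelTorusOperator (TDomains)
open B6Geom246MultiLevelBox (bset)
open B6Geom246MultiLevelTorus (geomT triangle_refl_nonneg_T)
open B6GlobalChartV1 (PV domT blkV1)
open B6CubeWindowV1 (GlobalBand)
open B6Lemma21Repaired (Ineq261With)
open B6RandomWalk (blockPiece)
open B6RandomWalkL2 (l2n l2n_sq l2n_nonneg HasL2Majorant)
open B8Ineq192MultiLevelTorus (symmT)
open B6Ineq2133TwoScaleV1 (onFun onFun_apply)
open B6GradLegKLevelV1 (DV)
open B6LapLegKLevelV1 (DVa)
open B6VecIMSV1 (ims_deltaAE)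
open B6IMSTermsV1 (abs_E1_le abs_src_le src_eq_zero sum_sq_DV_le_ims le_add_sqrt_mul_of_sq_le)
open B6CutoffSupportKLevelV1 (exists_blockCutoffT dist_le_of_shift_ne)
open B6IMSTermsKLevelV1 (sum_sq_near_le TQ_le TP_le)
open Literature.MathematicalPhysics.QuantumFieldTheory.BalabanImbrieJaffe1984to88.BIJ85AxialPropagator411 (BondSpace)

variable {d ℓ m K : ℕ} {hd : 1 ≤ d + 1} {hL : Odd (ℓ + 1) ∧ 1 < ℓ + 1} {Mh k R : ℕ} {P' : Fin (d + 1) → ℕ}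
variable (hN : ∀ μ, N0 ℓ Mh k P' μ = (PV d ℓ m K hd hL).sitesPerDir 0) (D : TDomains d ℓ Mh k P' R) (hk : k ≤ m + K)

/-- **THE SOURCE TERM, NEAR OR FAR**: if `χ` lives within `r` of `y` and `supp u ⊂ Δ(y′)`, then `Σ_b χ²v·∇*_μu` vanishes unless
`d_T(y,y′) ≤ r + 1`, and in that case it is `≤ (eEU)·X + eS·E²U²` given `‖X_μ‖ ≤ X`, `|c_f|δχ‖1_N v‖ ≤ S·E·U` and `1 ≤ eE`.
[cite: Balaban1984PropagatorsII, Prop. 2.6 (2.140) p.247; Balaban1984PropagatorsI, (1.21) p.21] -/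
theorem abs_src_le_of_near (hMh : 1 ≤ Mh) (hP : ∀ μ, 1 ≤ P' μ) (y y' : ↥(bset D.toDomains)) (μ : Fin (d + 1)) (cf : ℝ)
    {δχ : ℝ} (hδχ0 : 0 ≤ δχ) (χ v u : PBond (PV d ℓ m K hd hL) 0 → ℝ) (h01 : ∀ b, 0 ≤ χ b ∧ χ b ≤ 1)
    (hLip : ∀ b : PBond (PV d ℓ m K hd hL) 0, |χ ⟨b.src.shift μ, b.dir⟩ - χ b| ≤ δχ) {r : ℝ}
    (hsuppr : ∀ f, χ f ≠ 0 → (geomT D).dist (blkV1 hN D f) y ≤ r) (hu : ∀ b, blkV1 hN D b ≠ y' → u b = 0)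
    {X S E e : ℝ} (hX0 : 0 ≤ X) (hS0 : 0 ≤ S) (hE0 : 0 ≤ E) (he0 : 0 ≤ e)
    (hXμ : l2n (fun b : PBond (PV d ℓ m K hd hL) 0 =>
      cf * (χ ⟨b.src.shift μ, b.dir⟩ * v ⟨b.src.shift μ, b.dir⟩ - χ b * v b)) ≤ X)
    (hNB : |cf| * δχ * l2n (fun b : PBond (PV d ℓ m K hd hL) 0 => if χ ⟨b.src.shift μ, b.dir⟩ = χ b then 0 else v b) ≤
      S * E * l2n u)
    (hind : (geomT D).dist y y' ≤ r + 1 → 1 ≤ e * E) :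
    |∑ b, χ b ^ 2 * v b * DVa μ cf u b| ≤ (e * E * l2n u) * X + e * S * (E ^ 2 * l2n u ^ 2) := by
  have htri := (triangle_refl_nonneg_T D hMh hP).1
  have hU0 : 0 ≤ l2n u := l2n_nonneg u
  by_cases hfar : r + 1 < (geomT D).dist y y'
  · -- far apart: the source pairing vanishes
    have hχ0 : ∀ b, blkV1 hN D b = y' → χ b = 0 ∧ χ ⟨b.src.shift μ, b.dir⟩ = 0 := by
      intro b hb
      constructor
      · by_contra hne
        have h1 := hsuppr b hne
        rw [hb, symmT D y' y] at h1
        linarith only [h1, hfar]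
      · by_contra hne
        have h1 := hsuppr _ hne
        have h2 : (geomT D).dist (blkV1 hN D b) (blkV1 hN D ⟨b.src.shift μ, b.dir⟩) ≤ 1 := by
          show (((B6Geom246MultiLevelTorus.bondT D).dist _ _ : ℕ) : ℝ) ≤ 1
          exact_mod_cast B6Ineq2142KLevelV1.distT_shift_le_one hN D b.src μ
        rw [hb] at h2
        have t := htri y' (blkV1 hN D ⟨b.src.shift μ, b.dir⟩) y
        rw [symmT D y' y] at t
        linarith only [h1, h2, t, hfar]
    rw [src_eq_zero (blkV1 hN D) y' μ cf χ v u hχ0 hu, abs_zero]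
    positivity
  · have hind' := hind (not_lt.mp hfar)
    have h0 := abs_src_le μ cf hδχ0 χ v u h01 hLip
    refine h0.trans ?_
    have hfin1 : (l2n (fun b : PBond (PV d ℓ m K hd hL) 0 =>
          cf * (χ ⟨b.src.shift μ, b.dir⟩ * v ⟨b.src.shift μ, b.dir⟩ - χ b * v b)) +
        |cf| * δχ * l2n (fun b : PBond (PV d ℓ m K hd hL) 0 => if χ ⟨b.src.shift μ, b.dir⟩ = χ b then 0 else v b)) * l2n u ≤
        (X + S * E * l2n u) * l2n u := mul_le_mul_of_nonneg_right (add_le_add hXμ hNB) hU0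
    refine hfin1.trans ?_
    have hk : 0 ≤ e * E - 1 := by linarith only [hind']
    have e3 : (e * E * l2n u) * X + e * S * (E ^ 2 * l2n u ^ 2) - (X + S * E * l2n u) * l2n u =
        (e * E - 1) * (l2n u * X) + (e * E - 1) * (S * E * l2n u ^ 2) := by ring
    have h5 : 0 ≤ (e * E - 1) * (l2n u * X) := mul_nonneg hk (mul_nonneg hU0 hX0)
    have h6 : 0 ≤ (e * E - 1) * (S * E * l2n u ^ 2) := mul_nonneg hk (by positivity)
    linarith only [e3, h5, h6]

/-- **(2.140)₄ PER MEMBER AND PER PAIR OF BLOCKS, FROM THE LOCALISED ENERGY IDENTITY.**  With `r₂ = 4(d+1)`, `P₁ = e^{a(r₂+1)}K`,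
`M₁ = A₂Le^{δ_H(r₂+1)}` and
`B = e^{δ_e(r₂+1)}√P₁·M₁·L + e^{ar₂}K·A₂²(d+1)CK·e^{(δ_H+δ_e)r₂} + b₁·2(d+1)e^{a(r₂+L+2)}K·(L²·2L^{d+1}·(A₂Le^{δ_H(r₂+2L+4)})²) + (d+1)P₁M₁²L²`:
`‖Δ(y)(∇_ν G∇*_μ u)‖ ≤ (e^{δ_e(r₂+1)} + √B)·e^{−δ_e d_T(y,y′)}·‖u‖` for `supp u ⊂ Δ(y′)`.
[cite: Balaban1984PropagatorsII, Prop. 2.6 (2.140) p.247; Balaban1984PropagatorsI, (1.21) p.21] -/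
theorem l2n_blockPiece_DGDa_le (hMh : 1 ≤ Mh) (hP : ∀ μ, 1 ≤ P' μ) (hk1 : 1 ≤ k) (hRM2 : 2 ≤ R * Mh)
    (hRM6 : (d + 2) * 6 < R * ((ℓ + 1) * Mh) - 1) (hwin : 4 * ((d : ℝ) + 1) + 2 * ℓ + 7 < ((R * ((ℓ + 1) * Mh) - 1 : ℕ) : ℝ))
    {Kc a : ℝ} (h261 : Ineq261With Kc (geomT D) a 1) (ha : 0 ≤ a)
    {b₀ b₁ cf : ℝ} {w : BondIdx (domT hN D hk) → ℝ} (hwb : GlobalBand b₀ b₁ cf w) (hcf : cf ≠ 0) (hw : ∀ i, 0 < w i) (hb₁ : 0 ≤ b₁)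
    {C δP δe : ℝ} (hC : 0 ≤ C) (hδe : 0 ≤ δe) (haP : a + δe ≤ δP)
    (hS : HasL2Majorant (g := geomT D) (blkV1 hN D) (onFun (dE cf ∘ₗ (LinearMap.id - RE (domT hN D hk) cf) ∘ₗ dsE cf))
      (fun y₁ y₂ => cf ^ 2 * ((d : ℝ) + 1) * C / ((geomT D).len y₁ * (geomT D).len y₂) * Real.exp (-(δP * (geomT D).dist y₁ y₂))))
    {A₂ δH : ℝ} (hA₂ : 0 ≤ A₂) (hδH : δe ≤ δH) (μ : Fin (d + 1))
    (hH : HasL2Majorant (g := geomT D) (blkV1 hN D) (onFun (GE (domT hN D hk) hcf hw) ∘ₗ DVa μ cf)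
      (fun y₂ y' => A₂ * ((geomT D).len y₂ * |cf|⁻¹) * Real.exp (-(δH * (geomT D).dist y₂ y'))))
    (ν : Fin (d + 1)) (y y' : ↥(bset D.toDomains)) (u : PBond (PV d ℓ m K hd hL) 0 → ℝ) (hu : ∀ b, blkV1 hN D b ≠ y' → u b = 0) :
    l2n (blockPiece (g := geomT D) (blkV1 hN D) y ((DV ν cf ∘ₗ onFun (GE (domT hN D hk) hcf hw) ∘ₗ DVa μ cf) u)) ≤
      (Real.exp (δe * (4 * ((d : ℝ) + 1) + 1)) + Real.sqrt
        (Real.exp (δe * (4 * ((d : ℝ) + 1) + 1)) * Real.sqrt (Real.exp (a * (4 * ((d : ℝ) + 1) + 1)) * Kc) *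
            (A₂ * ((ℓ : ℝ) + 1) * Real.exp (δH * (4 * ((d : ℝ) + 1) + 1))) * ((ℓ : ℝ) + 1) +
          Real.exp (a * (4 * ((d : ℝ) + 1))) * Kc * (A₂ ^ 2 * ((d : ℝ) + 1) * C * Kc) * Real.exp ((δH + δe) * (4 * ((d : ℝ) + 1))) +
          b₁ * (2 * ((d : ℝ) + 1) * (Real.exp (a * (4 * ((d : ℝ) + 1) + ℓ + 3)) * Kc)) *
            ((((ℓ : ℝ) + 1)) ^ 2 * (2 * (((ℓ + 1 : ℕ) : ℝ)) ^ (d + 1)) *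
              (A₂ * ((ℓ : ℝ) + 1) * Real.exp (δH * (4 * ((d : ℝ) + 1) + 2 * ℓ + 6))) ^ 2) +
          ((d : ℝ) + 1) * (Real.exp (a * (4 * ((d : ℝ) + 1) + 1)) * Kc) *
            (A₂ * ((ℓ : ℝ) + 1) * Real.exp (δH * (4 * ((d : ℝ) + 1) + 1))) ^ 2 * ((ℓ : ℝ) + 1) ^ 2)) *
        Real.exp (-(δe * (geomT D).dist y y')) * l2n u := by
  classical
  have htri := (triangle_refl_nonneg_T D hMh hP).1
  have hnn := (triangle_refl_nonneg_T D hMh hP).2.2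
  have hL0 : (0 : ℝ) < (ℓ : ℝ) + 1 := by positivity
  have hL1 : (1 : ℝ) ≤ (ℓ : ℝ) + 1 := by linarith [(Nat.cast_nonneg ℓ : (0 : ℝ) ≤ ℓ)]
  have hacf : 0 < |cf| := abs_pos.2 hcf
  have hδH0 : 0 ≤ δH := hδe.trans' le_rfl |>.trans hδH |> fun h => le_trans hδe hδH
  have hKc : 0 ≤ Kc := le_trans (Finset.sum_nonneg fun _ _ => (Real.exp_pos _).le) (by have h := h261 y; rw [one_mul] at h; exact h)
  have hlen : ∀ z : ↥(bset D.toDomains), (geomT D).len z = ((ℓ : ℝ) + 1) ^ z.1.1 := fun z => by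
    show ((ℓ : ℝ) + 1) ^ z.1.1 * 1 = _; rw [mul_one]
  -- abbreviations
  set r₂ : ℝ := 4 * ((d : ℝ) + 1) with hr₂
  have hr₂0 : 0 ≤ r₂ := by positivity
  set dd : ℝ := (geomT D).dist y y' with hdd
  have hdd0 : 0 ≤ dd := hnn y y'
  set U : ℝ := l2n u with hU
  have hU0 : 0 ≤ U := l2n_nonneg u
  set E : ℝ := Real.exp (-(δe * dd)) with hE
  have hE0 : 0 < E := Real.exp_pos _
  -- the field `v = G∇*_μ u` and its block bound (2.140)₂
  set v : PBond (PV d ℓ m K hd hL) 0 → ℝ := onFun (GE (domT hN D hk) hcf hw) (DVa μ cf u) with hv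
  have hHv : ∀ y₂ : ↥(bset D.toDomains), l2n (blockPiece (g := geomT D) (blkV1 hN D) y₂ v) ≤
      A₂ * (((ℓ : ℝ) + 1) ^ y₂.1.1 * |cf|⁻¹) * Real.exp (-(δH * (geomT D).dist y₂ y')) * U := by
    intro y₂
    have h := hH y₂ y' u hu
    have e1 : (onFun (GE (domT hN D hk) hcf hw) ∘ₗ DVa μ cf) u = v := by rw [hv, LinearMap.comp_apply]
    rw [e1] at h
    refine h.trans (le_of_eq ?_)
    show A₂ * ((geomT D).len y₂ * |cf|⁻¹) * Real.exp (-(δH * (geomT D).dist y₂ y')) * l2n u = _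
    rw [hlen]
  -- the cut-off around `y`
  obtain ⟨n, χ, hn, h01, hpl, hsupp, hLip⟩ := exists_blockCutoffT hN D hk hMh hP y hRM6
  have hsuppr : ∀ f, χ f ≠ 0 → (geomT D).dist (blkV1 hN D f) y ≤ r₂ := fun f hf => by rw [hr₂]; exact hsupp f hf
  set δχ : ℝ := ((((ℓ : ℝ) + 1)) ^ n)⁻¹ with hδχ
  have hδχ0 : 0 ≤ δχ := by positivity
  -- `δχ · L^{j(y)} ≤ L`
  have hδχL : δχ * ((ℓ : ℝ) + 1) ^ y.1.1 ≤ (ℓ : ℝ) + 1 := by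
    have hjn : y.1.1 ≤ n + 1 := by rw [hn]; omega
    have h1 : ((ℓ : ℝ) + 1) ^ y.1.1 ≤ ((ℓ : ℝ) + 1) ^ n * ((ℓ : ℝ) + 1) := by
      rw [← pow_succ]; exact pow_le_pow_right₀ hL1 hjn
    have hpos : 0 < ((ℓ : ℝ) + 1) ^ n := by positivity
    rw [hδχ]
    calc (((ℓ : ℝ) + 1) ^ n)⁻¹ * ((ℓ : ℝ) + 1) ^ y.1.1 ≤ (((ℓ : ℝ) + 1) ^ n)⁻¹ * (((ℓ : ℝ) + 1) ^ n * ((ℓ : ℝ) + 1)) :=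
          mul_le_mul_of_nonneg_left h1 (by positivity)
      _ = (ℓ : ℝ) + 1 := by field_simp
  set P₁ : ℝ := Real.exp (a * (r₂ + 1)) * Kc with hP₁
  set M₁ : ℝ := A₂ * ((ℓ : ℝ) + 1) * Real.exp (δH * (r₂ + 1)) with hM₁
  have hP10 : 0 ≤ P₁ := by positivity
  have hM10 : 0 ≤ M₁ := by positivity
  obtain ⟨Bsum, hBsum⟩ : ∃ B : ℝ, B = Real.exp (δe * (r₂ + 1)) * Real.sqrt P₁ * M₁ * ((ℓ : ℝ) + 1) +
      Real.exp (a * r₂) * Kc * (A₂ ^ 2 * ((d : ℝ) + 1) * C * Kc) * Real.exp ((δH + δe) * r₂) +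
      b₁ * (2 * ((d : ℝ) + 1) * (Real.exp (a * (r₂ + ℓ + 3)) * Kc)) *
        ((((ℓ : ℝ) + 1)) ^ 2 * (2 * (((ℓ + 1 : ℕ) : ℝ)) ^ (d + 1)) * (A₂ * ((ℓ : ℝ) + 1) * Real.exp (δH * (r₂ + 2 * ℓ + 6))) ^ 2) +
      ((d : ℝ) + 1) * P₁ * M₁ ^ 2 * ((ℓ : ℝ) + 1) ^ 2 := ⟨_, rfl⟩
  have hBsum0 : 0 ≤ Bsum := by rw [hBsum]; positivity
  have hCP0 : 0 ≤ Real.exp (a * r₂) * Kc * (A₂ ^ 2 * ((d : ℝ) + 1) * C * Kc) * Real.exp ((δH + δe) * r₂) := by positivity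
  have hCQ0 : 0 ≤ b₁ * (2 * ((d : ℝ) + 1) * (Real.exp (a * (r₂ + ℓ + 3)) * Kc)) *
      ((((ℓ : ℝ) + 1)) ^ 2 * (2 * (((ℓ + 1 : ℕ) : ℝ)) ^ (d + 1)) * (A₂ * ((ℓ : ℝ) + 1) * Real.exp (δH * (r₂ + 2 * ℓ + 6))) ^ 2) := by
    positivity
  -- THE IDENTITY
  have hims := ims_deltaAE (domT hN D hk) cf w (WithLp.toLp 2 v) χ
  rw [WithLp.ofLp_toLp] at hims
  set Xsq : ℝ := ∑ ν' : Fin (d + 1), ∑ b : PBond (PV d ℓ m K hd hL) 0,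
    (cf * (χ ⟨b.src.shift ν', b.dir⟩ * v ⟨b.src.shift ν', b.dir⟩ - χ b * v b)) ^ 2 with hXsq
  have hXsq0 : 0 ≤ Xsq := Finset.sum_nonneg fun _ _ => Finset.sum_nonneg fun _ _ => sq_nonneg _
  set X : ℝ := Real.sqrt Xsq with hX
  have hX0 : 0 ≤ X := Real.sqrt_nonneg _
  have hXX : X ^ 2 = Xsq := Real.sq_sqrt hXsq0
  -- (i) the source term
  have hA : (WithLp.toLp 2 v : BondSpace (PV d ℓ m K hd hL)) = GE (domT hN D hk) hcf hw (WithLp.toLp 2 (DVa μ cf u)) := by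
    rw [hv]; simp [onFun]
  have hI1 : ⟪(WithLp.toLp 2 fun b => χ b ^ 2 * v b : BondSpace (PV d ℓ m K hd hL)), deltaAE (domT hN D hk) cf w (WithLp.toLp 2 v)⟫_ℝ
      = ∑ b, χ b ^ 2 * v b * DVa μ cf u b := by
    rw [hA, deltaAE_GE, inner_eq_sum]
    try rfl
  -- the set of bonds where `χ` jumps and its size
  set Nsum : ℝ := ∑ b : PBond (PV d ℓ m K hd hL) 0, (if (geomT D).dist (blkV1 hN D b) y ≤ r₂ + 1 then v b ^ 2 else 0) with hNsum
  have hNsum0 : 0 ≤ Nsum := Finset.sum_nonneg fun b _ => by split_ifs <;> positivity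
  have hNle : Nsum ≤ P₁ * (M₁ * ((ℓ : ℝ) + 1) ^ y.1.1 * |cf|⁻¹ * Real.exp (-(δH * dd)) * U) ^ 2 := by
    have h := sum_sq_near_le hN D hMh hP h261 ha y y' (r := r₂ + 1) (by linarith only [hwin, hL0]) v hA₂ hδH0 hU0 hHv
    refine h.trans (le_of_eq ?_)
    simp only [hP₁, hM₁]; ring
  have hsqrtN : Real.sqrt Nsum ≤ Real.sqrt P₁ * (M₁ * ((ℓ : ℝ) + 1) ^ y.1.1 * |cf|⁻¹ * Real.exp (-(δH * dd)) * U) := by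
    have hM0 : 0 ≤ M₁ * ((ℓ : ℝ) + 1) ^ y.1.1 * |cf|⁻¹ * Real.exp (-(δH * dd)) * U :=
      mul_nonneg (mul_nonneg (mul_nonneg (mul_nonneg hM10 (pow_nonneg hL0.le _)) (inv_nonneg.2 (abs_nonneg _)))
        (Real.exp_pos _).le) hU0
    calc Real.sqrt Nsum ≤ Real.sqrt (P₁ * (M₁ * ((ℓ : ℝ) + 1) ^ y.1.1 * |cf|⁻¹ * Real.exp (-(δH * dd)) * U) ^ 2) :=
          Real.sqrt_le_sqrt hNle
      _ = _ := by rw [Real.sqrt_mul hP10, Real.sqrt_sq hM0]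
  -- the `1_N v` of the source lemma is dominated by `Nsum`
  have hYle : l2n (fun b : PBond (PV d ℓ m K hd hL) 0 => if χ ⟨b.src.shift μ, b.dir⟩ = χ b then 0 else v b) ≤ Real.sqrt Nsum := by
    have h1 : l2n (fun b : PBond (PV d ℓ m K hd hL) 0 => if χ ⟨b.src.shift μ, b.dir⟩ = χ b then 0 else v b) ^ 2 ≤ Nsum := by
      rw [l2n_sq, hNsum]
      refine Finset.sum_le_sum fun b _ => ?_
      by_cases hc : χ ⟨b.src.shift μ, b.dir⟩ = χ b
      · rw [if_pos hc]
        have : (0 : ℝ) ≤ (if (geomT D).dist (blkV1 hN D b) y ≤ r₂ + 1 then v b ^ 2 else 0) := by split_ifs <;> positivity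
        simpa using this
      · rw [if_neg hc, if_pos (dist_le_of_shift_ne hN D hMh hP y hsuppr b μ hc).1]
    calc l2n _ = Real.sqrt (l2n (fun b : PBond (PV d ℓ m K hd hL) 0 => if χ ⟨b.src.shift μ, b.dir⟩ = χ b then 0 else v b) ^ 2) :=
          (Real.sqrt_sq (l2n_nonneg _)).symm
      _ ≤ Real.sqrt Nsum := Real.sqrt_le_sqrt h1
  -- `X_μ ≤ X`
  have hXμ : l2n (fun b : PBond (PV d ℓ m K hd hL) 0 => cf * (χ ⟨b.src.shift μ, b.dir⟩ * v ⟨b.src.shift μ, b.dir⟩ - χ b * v b)) ≤ X := by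
    rw [hX, ← Real.sqrt_sq (l2n_nonneg _)]
    refine Real.sqrt_le_sqrt ?_
    rw [l2n_sq, hXsq]
    exact Finset.single_le_sum (f := fun ν' : Fin (d + 1) => ∑ b : PBond (PV d ℓ m K hd hL) 0,
      (cf * (χ ⟨b.src.shift ν', b.dir⟩ * v ⟨b.src.shift ν', b.dir⟩ - χ b * v b)) ^ 2)
      (fun ν' _ => Finset.sum_nonneg fun b _ => sq_nonneg _) (Finset.mem_univ μ)
  -- the source term through `abs_src_le_of_near`
  have hEH : Real.exp (-(δH * dd)) ≤ E := by
    rw [hE]; exact Real.exp_le_exp.2 (neg_le_neg (mul_le_mul_of_nonneg_right hδH hdd0))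
  have hNB : |cf| * δχ * l2n (fun b : PBond (PV d ℓ m K hd hL) 0 => if χ ⟨b.src.shift μ, b.dir⟩ = χ b then 0 else v b) ≤
      Real.sqrt P₁ * M₁ * ((ℓ : ℝ) + 1) * E * U := by
    refine (mul_le_mul_of_nonneg_left (hYle.trans hsqrtN) (mul_nonneg hacf.le hδχ0)).trans ?_
    have hc1 : |cf| * |cf|⁻¹ = 1 := mul_inv_cancel₀ hacf.ne'
    have hid : |cf| * δχ * (Real.sqrt P₁ * (M₁ * ((ℓ : ℝ) + 1) ^ y.1.1 * |cf|⁻¹ * Real.exp (-(δH * dd)) * U)) =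
        (|cf| * |cf|⁻¹) * (Real.sqrt P₁ * M₁ * (δχ * ((ℓ : ℝ) + 1) ^ y.1.1 * Real.exp (-(δH * dd)) * U)) := by ring
    rw [hid, hc1, one_mul]
    have hP0 : 0 ≤ Real.sqrt P₁ * M₁ := mul_nonneg (Real.sqrt_nonneg _) hM10
    have hm : δχ * ((ℓ : ℝ) + 1) ^ y.1.1 * Real.exp (-(δH * dd)) ≤ ((ℓ : ℝ) + 1) * E :=
      mul_le_mul hδχL hEH (Real.exp_pos _).le hL0.le
    have h3 := mul_le_mul_of_nonneg_left (mul_le_mul_of_nonneg_right hm hU0) hP0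
    have e2 : Real.sqrt P₁ * M₁ * ((ℓ : ℝ) + 1) * E * U = Real.sqrt P₁ * M₁ * (((ℓ : ℝ) + 1) * E * U) := by ring
    rw [e2]
    exact h3
  have hind : dd ≤ r₂ + 1 → 1 ≤ Real.exp (δe * (r₂ + 1)) * E := fun hfar' => by
    rw [hE, ← Real.exp_add]
    apply Real.one_le_exp
    have := mul_le_mul_of_nonneg_left hfar' hδe
    linarith only [this]
  have hsrc := abs_src_le_of_near hN D hMh hP y y' μ cf hδχ0 χ v u h01 (fun b => hLip b μ) hsuppr hu hX0
    (mul_nonneg (mul_nonneg (Real.sqrt_nonneg _) hM10) hL0.le) hE0.le (Real.exp_pos _).le hXμ hNB hind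
  rw [← hU] at hsrc
  -- (ii) the `∂P∂*` term
  have hI2 : ⟪(WithLp.toLp 2 fun b => χ b ^ 2 * v b : BondSpace (PV d ℓ m K hd hL)),
      (dE cf ∘ₗ (LinearMap.id - RE (domT hN D hk) cf) ∘ₗ dsE cf) (WithLp.toLp 2 v)⟫_ℝ =
      ∑ b, χ b ^ 2 * v b * (onFun (dE cf ∘ₗ (LinearMap.id - RE (domT hN D hk) cf) ∘ₗ dsE cf)) v b := by
    rw [inner_eq_sum]; rfl
  have hTP := TP_le hN D hMh hP h261 ha y y' χ v h01 hsuppr hcf hC hδe haP hS hA₂ hδH hU0 hHv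
  -- (iii) the `Q*aQ` term
  have hTQ := TQ_le hN D hk hMh hP hk1 hRM2 h261 ha hwb hcf (fun i => (hw i).le) hb₁ y y' (r := r₂) (by linarith only [hwin]) χ v h01 hsuppr
    hA₂ hδH0 hU0 hHv
  -- (iv) the error term
  have hE1 := abs_E1_le cf δχ v χ (fun b => (geomT D).dist (blkV1 hN D b) y ≤ r₂ + 1) (fun b ν' => hLip b ν')
    (fun b ν' hne => dist_le_of_shift_ne hN D hMh hP y hsuppr b ν' hne)
  have hE1' : |∑ ν' : Fin (d + 1), ∑ b : PBond (PV d ℓ m K hd hL) 0,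
      cf ^ 2 * (χ ⟨b.src.shift ν', b.dir⟩ - χ b) ^ 2 * (v b * v ⟨b.src.shift ν', b.dir⟩)| ≤
      ((d : ℝ) + 1) * P₁ * M₁ ^ 2 * ((ℓ : ℝ) + 1) ^ 2 * (E ^ 2 * U ^ 2) := by
    refine hE1.trans ?_
    have hd1 : (((PV d ℓ m K hd hL).d : ℕ) : ℝ) = (d : ℝ) + 1 := by
      show (((d + 1 : ℕ)) : ℝ) = _; push_cast; ring
    rw [hd1]
    refine (mul_le_mul_of_nonneg_left hNle (by positivity)).trans ?_
    have hEH : Real.exp (-(δH * dd)) ≤ E := by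
      rw [hE]; exact Real.exp_le_exp.2 (neg_le_neg (mul_le_mul_of_nonneg_right hδH hdd0))
    have hc2 : cf ^ 2 * |cf|⁻¹ ^ 2 = 1 := by
      rw [← sq_abs cf, ← mul_pow, mul_inv_cancel₀ hacf.ne', one_pow]
    have hid : cf ^ 2 * δχ ^ 2 * ((d : ℝ) + 1) * (P₁ * (M₁ * ((ℓ : ℝ) + 1) ^ y.1.1 * |cf|⁻¹ * Real.exp (-(δH * dd)) * U) ^ 2) =
        (cf ^ 2 * |cf|⁻¹ ^ 2) *
          (((d : ℝ) + 1) * P₁ * M₁ ^ 2 * (δχ * ((ℓ : ℝ) + 1) ^ y.1.1) ^ 2 * (Real.exp (-(δH * dd)) ^ 2 * U ^ 2)) := by ring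
    rw [hid, hc2, one_mul]
    have hx : (δχ * ((ℓ : ℝ) + 1) ^ y.1.1) ^ 2 ≤ ((ℓ : ℝ) + 1) ^ 2 :=
      pow_le_pow_left₀ (mul_nonneg hδχ0 (pow_nonneg hL0.le _)) hδχL 2
    have he : Real.exp (-(δH * dd)) ^ 2 * U ^ 2 ≤ E ^ 2 * U ^ 2 :=
      mul_le_mul_of_nonneg_right (pow_le_pow_left₀ (Real.exp_pos _).le hEH 2) (sq_nonneg _)
    have hc0 : 0 ≤ ((d : ℝ) + 1) * P₁ * M₁ ^ 2 := mul_nonneg (mul_nonneg (by positivity) hP10) (sq_nonneg _)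
    calc ((d : ℝ) + 1) * P₁ * M₁ ^ 2 * (δχ * ((ℓ : ℝ) + 1) ^ y.1.1) ^ 2 * (Real.exp (-(δH * dd)) ^ 2 * U ^ 2)
        ≤ ((d : ℝ) + 1) * P₁ * M₁ ^ 2 * ((ℓ : ℝ) + 1) ^ 2 * (Real.exp (-(δH * dd)) ^ 2 * U ^ 2) :=
          mul_le_mul_of_nonneg_right (mul_le_mul_of_nonneg_left hx hc0) (mul_nonneg (sq_nonneg _) (sq_nonneg _))
      _ ≤ ((d : ℝ) + 1) * P₁ * M₁ ^ 2 * ((ℓ : ℝ) + 1) ^ 2 * (E ^ 2 * U ^ 2) :=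
          mul_le_mul_of_nonneg_left he (mul_nonneg hc0 (sq_nonneg _))
  -- Xsq ≤ aX + b
  have hquad : X ^ 2 ≤ (Real.exp (δe * (r₂ + 1)) * E * U) * X + Bsum * (E ^ 2 * U ^ 2) := by
    rw [hXX]
    have hsplit : Xsq ≤ |∑ b, χ b ^ 2 * v b * DVa μ cf u b| +
        |∑ b, χ b ^ 2 * v b * (onFun (dE cf ∘ₗ (LinearMap.id - RE (domT hN D hk) cf) ∘ₗ dsE cf)) v b| +
        |⟪QE (domT hN D hk) (WithLp.toLp 2 fun b => χ b ^ 2 * v b : BondSpace (PV d ℓ m K hd hL)),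
            aE (domT hN D hk) w (QE (domT hN D hk) (WithLp.toLp 2 v))⟫_ℝ| +
        |∑ ν' : Fin (d + 1), ∑ b : PBond (PV d ℓ m K hd hL) 0,
            cf ^ 2 * (χ ⟨b.src.shift ν', b.dir⟩ - χ b) ^ 2 * (v b * v ⟨b.src.shift ν', b.dir⟩)| := by
      rw [hims, hI1, hI2]
      linarith only [le_abs_self (∑ b, χ b ^ 2 * v b * DVa μ cf u b),
        le_abs_self (∑ b, χ b ^ 2 * v b * (onFun (dE cf ∘ₗ (LinearMap.id - RE (domT hN D hk) cf) ∘ₗ dsE cf)) v b),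
        neg_abs_le (⟪QE (domT hN D hk) (WithLp.toLp 2 fun b => χ b ^ 2 * v b : BondSpace (PV d ℓ m K hd hL)),
            aE (domT hN D hk) w (QE (domT hN D hk) (WithLp.toLp 2 v))⟫_ℝ),
        le_abs_self (∑ ν' : Fin (d + 1), ∑ b : PBond (PV d ℓ m K hd hL) 0,
            cf ^ 2 * (χ ⟨b.src.shift ν', b.dir⟩ - χ b) ^ 2 * (v b * v ⟨b.src.shift ν', b.dir⟩))]
    refine hsplit.trans ?_
    -- the two middle terms in terms of `E² U²`
    have hE2P : Real.exp (-((δH + δe) * dd)) ≤ E ^ 2 := by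
      rw [hE, ← Real.exp_nat_mul]; apply Real.exp_le_exp.2; push_cast
      nlinarith only [mul_le_mul_of_nonneg_right hδH hdd0, hdd0, hδe]
    have hE2Q : Real.exp (-(2 * δH * dd)) ≤ E ^ 2 := by
      rw [hE, ← Real.exp_nat_mul]; apply Real.exp_le_exp.2; push_cast
      nlinarith only [mul_le_mul_of_nonneg_right hδH hdd0, hdd0, hδe]
    have hTP' : |∑ b, χ b ^ 2 * v b * (onFun (dE cf ∘ₗ (LinearMap.id - RE (domT hN D hk) cf) ∘ₗ dsE cf)) v b| ≤
        Real.exp (a * r₂) * Kc * (A₂ ^ 2 * ((d : ℝ) + 1) * C * Kc) * Real.exp ((δH + δe) * r₂) * (E ^ 2 * U ^ 2) := by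
      refine hTP.trans ?_
      rw [mul_assoc _ (Real.exp (-((δH + δe) * dd))) (U ^ 2)]
      exact mul_le_mul_of_nonneg_left (mul_le_mul_of_nonneg_right hE2P (sq_nonneg _)) hCP0
    have hTQ' : |⟪QE (domT hN D hk) (WithLp.toLp 2 fun b => χ b ^ 2 * v b : BondSpace (PV d ℓ m K hd hL)),
            aE (domT hN D hk) w (QE (domT hN D hk) (WithLp.toLp 2 v))⟫_ℝ| ≤
        b₁ * (2 * ((d : ℝ) + 1) * (Real.exp (a * (r₂ + ℓ + 3)) * Kc)) *
          ((((ℓ : ℝ) + 1)) ^ 2 * (2 * (((ℓ + 1 : ℕ) : ℝ)) ^ (d + 1)) * (A₂ * ((ℓ : ℝ) + 1) * Real.exp (δH * (r₂ + 2 * ℓ + 6))) ^ 2) *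
          (E ^ 2 * U ^ 2) := by
      refine hTQ.trans ?_
      rw [mul_assoc _ (Real.exp (-(2 * δH * dd))) (U ^ 2)]
      exact mul_le_mul_of_nonneg_left (mul_le_mul_of_nonneg_right hE2Q (sq_nonneg _)) hCQ0
    have hsum4 := add_le_add (add_le_add (add_le_add hsrc hTP') hTQ') hE1'
    refine hsum4.trans (le_of_eq ?_)
    rw [hBsum]; ring
  -- close the quadratic inequality
  rw [show E ^ 2 * U ^ 2 = (E * U) ^ 2 by ring] at hquad
  have hXle := le_add_sqrt_mul_of_sq_le (mul_nonneg (mul_nonneg (Real.exp_pos _).le hE0.le) hU0) hBsum0 (mul_nonneg hE0.le hU0) hquad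
  -- the block piece of `∇_ν v` is dominated by `X`
  have hpiece : l2n (blockPiece (g := geomT D) (blkV1 hN D) y ((DV ν cf ∘ₗ onFun (GE (domT hN D hk) hcf hw) ∘ₗ DVa μ cf) u)) ≤ X := by
    rw [hX, ← Real.sqrt_sq (l2n_nonneg _)]
    refine Real.sqrt_le_sqrt ?_
    rw [l2n_sq]
    have h1 := sum_sq_DV_le_ims ν cf χ v (fun b => blkV1 hN D b = y) (fun b hb => hpl b hb ν)
    refine le_trans (le_of_eq (Finset.sum_congr rfl fun b _ => ?_)) h1
    simp only [blockPiece, LinearMap.comp_apply]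
    split_ifs with hb hb' hb'
    · rfl
    · exact absurd hb hb'
    · exact absurd hb' hb
    · rfl
  refine hpiece.trans (hXle.trans (le_of_eq ?_))
  rw [hBsum]
  ring

end Literature.MathematicalPhysics.QuantumFieldTheory.Balaban1983to89.B6Ineq2140GradGDivKLevelV1
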